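import Summits.CriticalPhenomena.PercolationContinuityZ3.Theses.PercExchangeRateTransport
import Summits.CriticalPhenomena.PercolationContinuityZ3.Theorems.PercNearOneGluingNoHeavyLowerTailCSHTheoremOne
import HarnessLib

/-!
# `PercExchangeRateTransport.PlanarAnchor` (stmt-CriticalPhenomena-16066) — SETTLED after continuity

Item `stmt-CriticalPhenomena-16066` of route `CriticalPhenomena/PercExchangeRateTransport` (support (XL as filed)): the planar anchor `θ_{ℤ²}(p_c(ℤ²)) = 0` (Harris 1960 + Kesten 1980), i.e. `PercolationContinuity 2`.

The tree theorem `CSH.percolationContinuity_allDimensions : ∀ d ≥ 2, PercolationContinuity d` (p205010: Kozma–Nitzan's Theorem 6 applied to the proved Conjecture 3) at `d = 2`.  (The item was filed 'XL' against the named facts `kesten_criticalProb_Z2`, `harris_theta_half`; neither is needed.)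

builds on p205010 (kernel theorem, internal audit signed; external expert review pending) — USED (`CSH.percolationContinuityZ3_holds`).  RSW3 lane, lead gen 28 (prover-prim-rsw3-lead-g28-0):
'after continuity — the ledger harvest'.
References: G. Kozma, N. Nitzan (2024), Thm. 6 / Conj. 3 [KozmaNitzan2024]; G. Grimmett, *Percolation* (1999), §8 [GrimmettPercolation1999].
-/

noncomputable section

namespace Summit.CriticalPhenomena.PercolationContinuityZ3.Theorems

namespace PercExchangeRateTransportPlanarAnchor

open MeasureTheory Literature.Probability.Percolation Literature.Probability.LatticeModels

/-- **`PercExchangeRateTransport.PlanarAnchor` (stmt-CriticalPhenomena-16066), settled.**  `CSH.percolationContinuity_allDimensions 2`.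
[cite: KozmaNitzan2024, Thm. 6 with Conj. 3 (p. 15)] -/
theorem planarAnchor_proof : Summit.CriticalPhenomena.PercolationContinuityZ3.Theses.PercExchangeRateTransport.PlanarAnchor := by
  unfold Summit.CriticalPhenomena.PercolationContinuityZ3.Theses.PercExchangeRateTransport.PlanarAnchor
  exact CSH.percolationContinuity_allDimensions 2 le_rfl

end PercExchangeRateTransportPlanarAnchor

end Summit.CriticalPhenomena.PercolationContinuityZ3.Theorems

end
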